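import Literature.NumberTheory.GaloisRepresentations.IdeleInflation
import HarnessLib

/-!
# The archimedean semi-local modules in a tower `F ⊆ E ⊆ E'`: `∏_{w∣v} E_wˣ → ∏_{w'∣v} E'_{w'}ˣ` at an infinite place
# `v`, as a morphism of pairs over `res : Gal(E'/F) → Gal(E/F)`, and its compatibility with the place projections of
# `J_E → J_{E'}` (Tate, C–F VII §1.1, §7.3)

Topic `NumberTheory/GaloisRepresentations`; namespaces `Literature.NumberTheory.GaloisRepresentations.ArchHerbrand` (§1–§3) and
`….IdeleCohomology` (§4).  The archimedean twin of `SemiLocalInflation.lean`: continues `IdeleInflation.lean` (`ideleInflHom`,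
`ideleInf`), `ArchimedeanHerbrand.lean` / `IdeleSUnitsRep.lean` (`infUnits E v = ∏_{w∣v} E_wˣ ≤ E_∞ˣ`, `cutoff E v`),
`SemiLocalArchimedeanShapiro.lean` (`archUnitsRep v`), `IdeleCohomologyLimit.lean` (`infPlaceProj v`), with the tree's
`InfiniteAdeleRing.baseChange E E'` / `infiniteCompletionOfComap E E' w' : E_{w'∩E} → E'_{w'}` (`Automorphic/AdeleBaseChange`) and
`galInfiniteCompletionMap_comp_infiniteCompletionOfComap_tower` (`Automorphic/IdeleNormTowerProofs`).  Definitions with bodies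
(`archInflHom`, `archInflRepHom`, `archSemiLocalInf`) and theorems; NO named fact, no `sorry`, no instance, no notation;
number fields in `Type`.

Mathematics.  At an infinite place `v` of `F`, the inclusions `E_w ⊆ E'_{w'}` (`w = w' ∩ E`) assemble to
`ι_v : ∏_{w∣v} E_wˣ → ∏_{w'∣v} E'_{w'}ˣ`, `(ι_v u)_{w'} = u_{w'∩E}`, `Gal(E'/F)`-equivariant through `res`, and `ι_v` is the
`v`-block of the base change of idèles `J_E → J_{E'}` (Tate VII §7.3, functoriality of `J_{L,S}` in `L`).  Hence
`Hⁿ(infPlaceProj_{E'} v) (Inf c) = Hⁿ(res, ι_v) (Hⁿ(infPlaceProj_E v) c)` (§4).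

## What is formalised

* §1 `isOver_iff_isOver_comap` (`w' ∣ v ↔ (w' ∩ E) ∣ v`), `galInfiniteCompletionMap_infiniteCompletionOfComap` (pointwise
  tower lemma), `restrictNormal_smul_comap_inv_smul`.
* §2 `archInflHom E E' v : infUnits E v →* infUnits E' v`, `coe_archInflHom_apply`, `archInflHom_cutoff`,
  **`coe_archInflHom_stableRepr`** (equivariance over `res`).
* §3 `archInflRepHom : Res_{res}(∏_{w∣v} E_wˣ) ⟶ ∏_{w'∣v} E'_{w'}ˣ` in `Rep ℤ Gal(E'/F)`, **`res_infPlaceProj_comp_archInflRepHom`**.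
* §4 `IdeleCohomology.archSemiLocalInf v n`, **`IdeleCohomology.map_infPlaceProj_ideleInf`**.

## References
* J. W. S. Cassels, A. Fröhlich (eds.), *Algebraic Number Theory* (1967), Ch. VII (Tate) §1.1, §7.3; Ch. II §10–§11.
  [CasselsFrohlichANT1967]
-/

noncomputable section

open NumberField NumberField.InfinitePlace IsDedekindDomain CategoryTheory groupCohomology
open Literature.NumberTheory.Automorphic

namespace Literature.NumberTheory.GaloisRepresentations

namespace ArchHerbrand

open Literature.Algebra.Homology
open scoped Classical

variable {F E E' : Type} [Field F] [NumberField F] [Field E] [NumberField E] [Field E'] [NumberField E']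
  [Algebra F E] [Algebra E E'] [Algebra F E'] [IsScalarTower F E E']

/-! ## §1. Places in the tower -/

omit [NumberField F] [NumberField E] [NumberField E'] in
/-- `w' ∣ v ↔ (w' ∩ E) ∣ v` for an infinite place `w'` of `E'`. [cite: CasselsFrohlichANT1967, Ch. II §11] -/
theorem isOver_iff_isOver_comap {v : InfinitePlace F} {w' : InfinitePlace E'} :
    IsOver E' v w' ↔ IsOver E v (w'.comap (algebraMap E E')) := by
  rw [IsOver, IsOver, InfinitePlace.comap_comap_tower F E E']

omit [NumberField F] [NumberField E] [NumberField E'] in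
/-- Pointwise form of the tree's `galInfiniteCompletionMap_comp_infiniteCompletionOfComap_tower`, for `τ W₁ = W`.
[cite: CasselsFrohlichANT1967, Ch. VII §1.1] -/
theorem galInfiniteCompletionMap_infiniteCompletionOfComap [Normal F E] (τ : E' ≃ₐ[F] E') {W₁ W : InfinitePlace E'}
    (hW : τ • W₁ = W) (hh : τ.restrictNormal E • W₁.comap (algebraMap E E') = W.comap (algebraMap E E'))
    (y : (W₁.comap (algebraMap E E')).Completion) :
    galInfiniteCompletionMap τ hW (infiniteCompletionOfComap E E' W₁ y) =
      infiniteCompletionOfComap E E' W (galInfiniteCompletionMap (τ.restrictNormal E) hh y) := by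
  obtain rfl : W₁ = τ⁻¹ • W := eq_inv_smul_iff.mpr hW
  exact congrFun (galInfiniteCompletionMap_comp_infiniteCompletionOfComap_tower (K := F) (K' := E) τ W hh) y

omit [NumberField F] [NumberField E] [NumberField E'] in
/-- `(τ|_E) • ((τ⁻¹ w') ∩ E) = w' ∩ E` for infinite places. [cite: CasselsFrohlichANT1967, Ch. VII §1.1] -/
theorem restrictNormal_smul_comap_inv_smul [Normal F E] (τ : E' ≃ₐ[F] E') (w' : InfinitePlace E') :
    τ.restrictNormal E • (τ⁻¹ • w').comap (algebraMap E E') = w'.comap (algebraMap E E') := by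
  rw [InfinitePlace.comap_tower_smul, show (τ⁻¹).restrictNormal E = (τ.restrictNormal E)⁻¹ from
    map_inv (AlgEquiv.restrictNormalHom E) τ, smul_inv_smul]

omit [NumberField F] [NumberField E] [NumberField E'] in
/-- `(τ⁻¹ w') ∩ E = (τ|_E)⁻¹ (w' ∩ E)`. [cite: CasselsFrohlichANT1967, Ch. VII §1.1] -/
theorem comap_inv_smul_eq [Normal F E] (τ : E' ≃ₐ[F] E') (w' : InfinitePlace E') :
    (τ⁻¹ • w').comap (algebraMap E E') = (τ.restrictNormal E)⁻¹ • w'.comap (algebraMap E E') := by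
  rw [InfinitePlace.comap_tower_smul, show (τ⁻¹).restrictNormal E = (τ.restrictNormal E)⁻¹ from
    map_inv (AlgEquiv.restrictNormalHom E) τ]

/-! ## §2. `ι_v : ∏_{w∣v} E_wˣ → ∏_{w'∣v} E'_{w'}ˣ` -/

variable (E E') in
/-- **`ι_v : ∏_{w∣v} E_wˣ →* ∏_{w'∣v} E'_{w'}ˣ`** at an infinite place `v`: base change of archimedean idèles
(`InfiniteAdeleRing.baseChange`) followed by the projection `cutoff E' v` onto the places above `v`.
[cite: CasselsFrohlichANT1967, Ch. VII §7.3] -/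
def archInflHom (v : InfinitePlace F) : infUnits E v →* infUnits E' v :=
  (cutoff E' v).comp ((Units.map (Literature.NumberTheory.Automorphic.InfiniteAdeleRing.baseChange E E').toMonoidHom).comp (infUnits E v).subtype)

omit [NumberField F] [NumberField E] [NumberField E'] [IsScalarTower F E E'] in
/-- Components of `ι_v u`: `u_{w'∩E}` seen in `E'_{w'}` above `v`, `1` elsewhere. [cite: CasselsFrohlichANT1967, Ch. VII §7.3] -/
theorem coe_archInflHom_apply (v : InfinitePlace F) (u : infUnits E v) (w' : InfinitePlace E') :
    (((archInflHom E E' v u : infUnits E' v) : (InfiniteAdeleRing E')ˣ) : InfiniteAdeleRing E') w' =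
      if IsOver E' v w' then
        infiniteCompletionOfComap E E' w' (((u : (InfiniteAdeleRing E)ˣ) : InfiniteAdeleRing E) (w'.comap (algebraMap E E')))
      else 1 := by
  change (((cutoff E' v (Units.map (Literature.NumberTheory.Automorphic.InfiniteAdeleRing.baseChange E E').toMonoidHom
    (u : (InfiniteAdeleRing E)ˣ)) :
    infUnits E' v) : (InfiniteAdeleRing E')ˣ) : InfiniteAdeleRing E') w' = _
  rw [coe_cutoff_apply]
  rfl

omit [NumberField F] [NumberField E] [NumberField E'] in
/-- **`ι_v ∘ cutoff_E v = cutoff_{E'} v ∘ (base change)`** on archimedean idèles. [cite: CasselsFrohlichANT1967, Ch. VII §7.3] -/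
theorem archInflHom_cutoff (v : InfinitePlace F) (x : (InfiniteAdeleRing E)ˣ) :
    archInflHom E E' v (cutoff E v x) = cutoff E' v (Units.map (Literature.NumberTheory.Automorphic.InfiniteAdeleRing.baseChange E E').toMonoidHom x) := by
  refine Subtype.ext (Units.ext (funext fun w' => ?_))
  rw [coe_archInflHom_apply,
    coe_cutoff_apply v (Units.map (Literature.NumberTheory.Automorphic.InfiniteAdeleRing.baseChange E E').toMonoidHom x) w']
  by_cases h : IsOver E' v w'
  · rw [if_pos h, if_pos h, coe_cutoff_apply_of_isOver x (isOver_iff_isOver_comap.1 h)]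
    rfl
  · rw [if_neg h, if_neg h]

omit [NumberField F] [NumberField E] [NumberField E'] in
/-- **`ι_v` is `Gal(E'/F)`-equivariant through `res`** (on underlying archimedean idèles): `ι_v ((τ|_E) • u) = τ • ι_v(u)`.
[cite: CasselsFrohlichANT1967, Ch. VII §1.1] -/
theorem coe_archInflHom_stableRepr [Normal F E] (v : InfinitePlace F) (τ : E' ≃ₐ[F] E') (x : Additive (infUnits E v)) :
    ((archInflHom E E' v (Additive.toMul (archUnitsRepr (E := E) v (AlgEquiv.restrictNormalHom E τ) x)) : infUnits E' v) :
        (InfiniteAdeleRing E')ˣ) =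
      τ • ((archInflHom E E' v (Additive.toMul x) : infUnits E' v) : (InfiniteAdeleRing E')ˣ) := by
  apply Units.ext
  funext w'
  rw [smul_units_apply, coe_archInflHom_apply, coe_archInflHom_apply]
  by_cases h : IsOver E' v w'
  · have h' : IsOver E' v (τ⁻¹ • w') := (isOver_smul_iff τ⁻¹).mpr h
    rw [if_pos h, if_pos h', galInfiniteCompletionMap_infiniteCompletionOfComap τ (smul_inv_smul τ w')
      (restrictNormal_smul_comap_inv_smul τ w')]
    change infiniteCompletionOfComap E E' w'
        ((((AlgEquiv.restrictNormalHom E τ) • ((Additive.toMul x : infUnits E v) : (InfiniteAdeleRing E)ˣ) :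
          (InfiniteAdeleRing E)ˣ) : InfiniteAdeleRing E) (w'.comap (algebraMap E E'))) = _
    rw [smul_units_apply]
    exact congrArg (infiniteCompletionOfComap E E' w')
      (galInfiniteCompletionMap_apply_congr_place F (w₁ := (τ.restrictNormal E)⁻¹ • w'.comap (algebraMap E E'))
        (w₂ := (τ⁻¹ • w').comap (algebraMap E E')) (w := w'.comap (algebraMap E E'))
        (comap_inv_smul_eq τ w').symm _ _ _)
  · rw [if_neg h, if_neg (mt (isOver_smul_iff τ⁻¹).mp h), map_one]

/-! ## §3. `ι_v` as a morphism of `Gal(E'/F)`-modules; the `v`-block of `J_E → J_{E'}` -/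

variable (E E') in
/-- **`ι_v : Res_{res}(∏_{w∣v} E_wˣ) ⟶ ∏_{w'∣v} E'_{w'}ˣ` in `Rep ℤ Gal(E'/F)`** (`archUnitsRep`, additively).
[cite: CasselsFrohlichANT1967, Ch. VII §7.3] -/
def archInflRepHom [Normal F E] (v : InfinitePlace F) :
    Rep.res (AlgEquiv.restrictNormalHom E) (archUnitsRep (E := E) v) ⟶ archUnitsRep (E := E') v :=
  Rep.ofHom (LinearMap.intertwiningMap_of_isIntertwiningMap _ _
    (MonoidHom.toAdditive (archInflHom E E' v)).toIntLinearMap fun τ x => by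
      apply (Additive.toMul (α := infUnits E' v)).injective
      apply Subtype.ext
      exact coe_archInflHom_stableRepr v τ x)

omit [NumberField F] [NumberField E] [NumberField E'] in
/-- Unfolding `archInflRepHom`. [cite: CasselsFrohlichANT1967, Ch. VII §7.3] -/
theorem toMul_archInflRepHom_apply [Normal F E] (v : InfinitePlace F) (x : Additive (infUnits E v)) :
    Additive.toMul ((archInflRepHom E E' v).hom x) = archInflHom E E' v (Additive.toMul x) := rfl

omit [NumberField F] in
/-- **`ι_v` is the `v`-block of the base change of idèles**: `infPlaceProj_{E'} v ∘ (J_E → J_{E'}) = ι_v ∘ infPlaceProj_E v`.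
[cite: CasselsFrohlichANT1967, Ch. VII §7.3] -/
theorem res_infPlaceProj_comp_archInflRepHom [Normal F E] (v : InfinitePlace F) :
    (Rep.resFunctor (AlgEquiv.restrictNormalHom E)).map (IdeleCohomology.infPlaceProj (E := E) v) ≫ archInflRepHom E E' v =
      IdeleCohomology.ideleInflHom F E E' ≫ IdeleCohomology.infPlaceProj (E := E') v := by
  refine Rep.hom_ext (Representation.IntertwiningMap.ext (LinearMap.ext fun x => ?_))
  apply (Additive.toMul (α := infUnits E' v)).injective
  change archInflHom E E' v (cutoff E v (IdeleHerbrand.infHom E (Additive.toMul x))) =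
    cutoff E' v (IdeleHerbrand.infHom E' (AdeleRing.ideleBaseChange E E' (Additive.toMul x)))
  rw [archInflHom_cutoff]
  rfl

end ArchHerbrand

/-! ## §4. `Inf` on `Hⁿ(G, J)` is compatible with the infinite-place projections -/

namespace IdeleCohomology

open Literature.Algebra.Homology ArchHerbrand

variable {F E E' : Type} [Field F] [NumberField F] [Field E] [NumberField E] [Field E'] [NumberField E']
  [Algebra F E] [Algebra E E'] [Algebra F E'] [IsScalarTower F E E'] [Normal F E]

variable (E E') in
/-- **The archimedean semi-local inflation `Hⁿ(res, ι_v)`.** [cite: CasselsFrohlichANT1967, Ch. VII §7.2] -/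
def archSemiLocalInf (v : InfinitePlace F) (n : ℕ) :
    groupCohomology (archUnitsRep (E := E) v) n ⟶ groupCohomology (archUnitsRep (E := E') v) n :=
  groupCohomology.map (AlgEquiv.restrictNormalHom E) (archInflRepHom E E' v) n

omit [NumberField F] in
/-- **`Hⁿ(infPlaceProj_{E'} v) ∘ Inf = Hⁿ(res, ι_v) ∘ Hⁿ(infPlaceProj_E v)`** on `Hⁿ(Gal(E/F), J_E)`.
[cite: CasselsFrohlichANT1967, Ch. VII §7.3] -/
theorem map_infPlaceProj_comp_ideleInf (v : InfinitePlace F) (n : ℕ) :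
    groupCohomology.map (MonoidHom.id (E ≃ₐ[F] E)) (A := IdeleClassGroup.ideleRep F E) (infPlaceProj v) n ≫
        archSemiLocalInf E E' v n =
      ideleInf F E E' n ≫
        groupCohomology.map (MonoidHom.id (E' ≃ₐ[F] E')) (A := IdeleClassGroup.ideleRep F E') (infPlaceProj v) n := by
  rw [archSemiLocalInf, ideleInf, ← groupCohomology.map_comp, ← groupCohomology.map_comp]
  exact map_congr' (by rw [MonoidHom.id_comp, MonoidHom.comp_id]) _ _
    (fun x => congrArg (fun φ => φ.hom x) (res_infPlaceProj_comp_archInflRepHom (F := F) (E := E) (E' := E') v)) n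

omit [NumberField F] in
/-- Element form: `Hⁿ(infPlaceProj_{E'} v) (Inf c) = Hⁿ(res, ι_v) (Hⁿ(infPlaceProj_E v) c)`.
[cite: CasselsFrohlichANT1967, Ch. VII §7.3] -/
theorem map_infPlaceProj_ideleInf (v : InfinitePlace F) (n : ℕ) (c : groupCohomology (IdeleClassGroup.ideleRep F E) n) :
    groupCohomology.map (MonoidHom.id (E' ≃ₐ[F] E')) (infPlaceProj (E := E') v) n (ideleInf F E E' n c) =
      archSemiLocalInf E E' v n (groupCohomology.map (MonoidHom.id (E ≃ₐ[F] E)) (infPlaceProj (E := E) v) n c) :=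
  (congrArg (fun φ => φ c) (map_infPlaceProj_comp_ideleInf (F := F) (E := E) (E' := E') v n)).symm

end IdeleCohomology

end Literature.NumberTheory.GaloisRepresentations

end
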